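import Summits.CriticalPhenomena.SAWScalingLimit.Theorems.SAWDefectDecoherenceDefectDecoherenceTmAdmissible
import Literature.Probability.RandomPlanarGeometry.HexParafermionProofs

/-!
# Transport of configurations of the crux `InteriorFlattening` along lattice similarities
(helper A for the stub `stub_compactnessAtOrigin`, line `liouville-local-limits`,
stmt-CriticalPhenomena-8297)

A graph automorphism `σ` of the honeycomb lattice `ℍ` acting on the embedded centres by a
complex-affine map `z ↦ κ z + μ` (`κ ≠ 0`; automatically `|κ| = 1`, an edge has length `1/√3`)
transports every object the crux speaks about: the Duminil-Copin–Smirnov observable at `x_c` is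
INVARIANT (`observable_image_eq`: walks transport bijectively with the same length and the same
geometric winding — `mapW`, `sum_mapW`, `lw_map` of `…TmAdmissible`), simply connected domains stay
simply connected (`simplyConnected_image`), boundary roots stay boundary roots (`boundary_image`),
Euclidean lattice balls go to lattice balls (`dist_image`, `ball_image`). Every vertex is moved to
every other one by such a similarity (`exists_iso_apply_eq`, from the dart charts
`HV.exists_chart`), and `rot3 v` (`…TipMartingaleDefs`) is the rotation by `+120°` about `c_v`.
No object of the pending Defs module of the line appears here. Registered sub-goal carried:
`observable_image_eq`.
-/

noncomputable section

open scoped BigOperators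
open Literature.Probability.LatticeModels Literature.Probability.RandomPlanarGeometry.SAW
open Summit.CriticalPhenomena.SAWScalingLimit.Theorems.DefectDecoherence.TipMartingale
  (mapW sum_mapW lw lw_map weight_eq_lw dist_hexCenter_of_adj adj_up)

namespace Summit.CriticalPhenomena.SAWScalingLimit.Theorems.InteriorFlattening.Liouville.Compactness

/-! ### Invariance of the observable -/

/-- **The DCS observable at `x_c` is invariant under lattice similarities**: for a graph
automorphism `σ` of `ℍ` acting on centres by `z ↦ κ z + μ` (`κ ≠ 0`),
`F_{σΛ, σa}(σz) = F_{Λ, a}(z)` at every spin. -/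
theorem observable_image (σ : hexGraph ≃g hexGraph) {κ μ : ℂ} (hκ : κ ≠ 0)
    (hσ : ∀ y, hexCenter (σ y) = κ * hexCenter y + μ) (Λ : Finset HexVertex)
    (a z : Sym2 HexVertex) (s : ℝ) :
    hexParafermionicObservable (Λ.image σ) (a.map σ) hexCriticalFugacity s (z.map σ) =
      hexParafermionicObservable Λ a hexCriticalFugacity s z := by
  rw [hexParafermionicObservable_def, hexParafermionicObservable_def]
  have h1 : ∑ γ : HexMidEdgeSAW (Λ.image σ) (a.map σ) (z.map σ), γ.weight hexCriticalFugacity s =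
      ∑ γ : HexMidEdgeSAW (Λ.image σ) (a.map σ) (z.map σ), lw (a.map σ) (z.map σ) s γ.verts :=
    Finset.sum_congr rfl fun γ _ => weight_eq_lw γ s
  have h2 : ∑ γ : HexMidEdgeSAW Λ a z, γ.weight hexCriticalFugacity s =
      ∑ γ : HexMidEdgeSAW Λ a z, lw a z s γ.verts :=
    Finset.sum_congr rfl fun γ _ => weight_eq_lw γ s
  rw [h1, h2, sum_mapW σ rfl rfl rfl fun l => lw (a.map σ) (z.map σ) s l]
  exact Finset.sum_congr rfl fun γ _ => lw_map hκ hσ a z s γ.verts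

/-! ### Domains, roots, balls -/

/-- Connectivity of induced subgraphs of `ℍ` is transported by an automorphism. -/
theorem preconnected_induce_image (σ : hexGraph ≃g hexGraph) {S : Set HexVertex}
    (h : (hexGraph.induce S).Preconnected) : (hexGraph.induce (σ '' S)).Preconnected := by
  let f : hexGraph.induce S →g hexGraph.induce (σ '' S) :=
    { toFun := fun v => ⟨σ v, v, v.2, rfl⟩
      map_rel' := fun {u v} huv => by
        simp only [SimpleGraph.induce_adj] at huv ⊢
        exact σ.map_rel_iff.2 huv }
  refine h.map f ?_
  rintro ⟨w, v, hv, rfl⟩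
  exact ⟨⟨v, hv⟩, rfl⟩

/-- **Simply connected domains are transported** ("connected complement" is a graph property). -/
theorem simplyConnected_image (σ : hexGraph ≃g hexGraph) {Λ : Finset HexVertex}
    (h : hexDomainSimplyConnected Λ) : hexDomainSimplyConnected (Λ.image σ) := by
  unfold hexDomainSimplyConnected at h ⊢
  have e : ((Λ.image σ : Finset HexVertex) : Set HexVertex)ᶜ = σ '' ((Λ : Set HexVertex)ᶜ) := by
    rw [Finset.coe_image, Set.image_compl_eq σ.bijective]
  rw [e]
  exact preconnected_induce_image σ h

/-- Membership in a transported domain. -/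
theorem mem_image_iff (σ : hexGraph ≃g hexGraph) {Λ : Finset HexVertex} {y : HexVertex} :
    σ y ∈ Λ.image σ ↔ y ∈ Λ := by
  constructor
  · intro h
    obtain ⟨y', hy', e⟩ := Finset.mem_image.1 h
    exact σ.injective e ▸ hy'
  · exact fun h => Finset.mem_image_of_mem _ h

/-- **Boundary roots are transported.** -/
theorem boundary_image (σ : hexGraph ≃g hexGraph) {Λ : Finset HexVertex} {a : Sym2 HexVertex}
    (h : a ∈ hexDomainBoundary Λ) : a.map σ ∈ hexDomainBoundary (Λ.image σ) := by
  obtain ⟨he, u, v, rfl, hv, hu⟩ := h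
  exact ⟨(SimpleGraph.Iso.map_mem_edgeSet_iff σ).2 he, σ u, σ v, by simp,
    (mem_image_iff σ).2 hv, fun h' => hu ((mem_image_iff σ).1 h')⟩

/-- **The similarity ratio of a lattice similarity is unimodular**: an edge of `ℍ` has length
`1/√3` before and after. -/
theorem norm_eq_one_of_affine (σ : hexGraph ≃g hexGraph) {κ μ : ℂ}
    (hσ : ∀ y, hexCenter (σ y) = κ * hexCenter y + μ) : ‖κ‖ = 1 := by
  have hadj : hexGraph.Adj (((0 : Site 2), (0 : Fin 2)) : HexVertex) ((0 : Site 2), (1 : Fin 2)) :=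
    adj_up 0
  have h1 := dist_hexCenter_of_adj hadj
  have h2 := dist_hexCenter_of_adj (σ.map_rel_iff.2 hadj)
  rw [Complex.dist_eq, hσ, hσ, show κ * hexCenter ((0 : Site 2), (0 : Fin 2)) + μ -
      (κ * hexCenter ((0 : Site 2), (1 : Fin 2)) + μ) =
      κ * (hexCenter ((0 : Site 2), (0 : Fin 2)) - hexCenter ((0 : Site 2), (1 : Fin 2))) by ring,
    norm_mul, ← Complex.dist_eq, h1] at h2
  have hpos : (0 : ℝ) < (Real.sqrt 3)⁻¹ := by positivity
  nlinarith [h2, hpos]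

/-- **Lattice similarities are isometries of the embedded lattice.** -/
theorem dist_image (σ : hexGraph ≃g hexGraph) {κ μ : ℂ}
    (hσ : ∀ y, hexCenter (σ y) = κ * hexCenter y + μ) (y y' : HexVertex) :
    dist (hexCenter (σ y)) (hexCenter (σ y')) = dist (hexCenter y) (hexCenter y') := by
  rw [Complex.dist_eq, Complex.dist_eq, hσ, hσ,
    show κ * hexCenter y + μ - (κ * hexCenter y' + μ) = κ * (hexCenter y - hexCenter y') by ring,
    norm_mul, norm_eq_one_of_affine σ hσ, one_mul]

/-- **Euclidean lattice balls are transported**: if the `R`-ball about `c_v` lies in `Λ`, the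
`R`-ball about `c_{σ v}` lies in `σ Λ`. -/
theorem ball_image (σ : hexGraph ≃g hexGraph) {κ μ : ℂ}
    (hσ : ∀ y, hexCenter (σ y) = κ * hexCenter y + μ) {Λ : Finset HexVertex} {v : HexVertex}
    {R : ℝ} (h : ∀ w : HexVertex, dist (hexCenter w) (hexCenter v) ≤ R → w ∈ Λ) :
    ∀ w : HexVertex, dist (hexCenter w) (hexCenter (σ v)) ≤ R → w ∈ Λ.image σ := by
  intro w hw
  obtain ⟨y, rfl⟩ := σ.surjective w
  rw [dist_image σ hσ] at hw
  exact Finset.mem_image_of_mem _ (h y hw)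

/-- Every vertex of `ℍ` has a neighbour. -/
theorem exists_adj (p : HexVertex) : ∃ q : HexVertex, hexGraph.Adj q p := by
  obtain ⟨x, j⟩ := p
  fin_cases j
  · exact ⟨(x, 1), (adj_up x).symm⟩
  · exact ⟨(x, 0), adj_up x⟩

/-- **Transitivity by similarities**: any vertex `v` of `ℍ` is carried to any other vertex `v'` by
a graph automorphism acting on centres by a complex-affine map (a translation, possibly composed
with the central flip `z ↦ -z` and a rotation by a multiple of `2π/3`). -/
theorem exists_iso_apply_eq (v v' : HexVertex) :
    ∃ (σ : hexGraph ≃g hexGraph) (κ μ : ℂ), κ ≠ 0 ∧ σ v = v' ∧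
      ∀ y, hexCenter (σ y) = κ * hexCenter y + μ := by
  obtain ⟨u, hu⟩ := exists_adj v
  obtain ⟨u', hu'⟩ := exists_adj v'
  obtain ⟨Φ, α, β, hα, -, hΦv, hΦ⟩ := HV.exists_chart hu
  obtain ⟨Φ', α', β', hα', -, hΦv', hΦ'⟩ := HV.exists_chart hu'
  refine ⟨Φ.trans Φ'.symm, α / α', (β - β') / α', div_ne_zero hα hα', ?_, fun y => ?_⟩
  · show Φ'.symm (Φ v) = v'
    rw [hΦv, RelIso.symm_apply_eq, hΦv']
  · show hexCenter (Φ'.symm (Φ y)) = α / α' * hexCenter y + (β - β') / α'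
    have e1 := hΦ' (Φ'.symm (Φ y))
    rw [RelIso.apply_symm_apply, hΦ] at e1
    field_simp
    linear_combination -e1

/-- **Registered sub-goal** (crux item stmt-CriticalPhenomena-8297, line `liouville-local-limits`,
helper for `stub_compactnessAtOrigin`): invariance of the DCS observable at `x_c` under lattice
similarities, registry form of `observable_image`. -/
theorem observable_image_eq :
    ∀ (σ : hexGraph ≃g hexGraph) (κ μ : ℂ), κ ≠ 0 → (∀ y, hexCenter (σ y) = κ * hexCenter y + μ) →
      ∀ (Λ : Finset HexVertex) (a z : Sym2 HexVertex) (s : ℝ),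
        hexParafermionicObservable (Λ.image σ) (a.map σ) hexCriticalFugacity s (z.map σ) =
          hexParafermionicObservable Λ a hexCriticalFugacity s z := by
  intro σ κ μ hκ hσ Λ a z s
  exact observable_image σ hκ hσ Λ a z s

end Summit.CriticalPhenomena.SAWScalingLimit.Theorems.InteriorFlattening.Liouville.Compactness

end
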